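import Summits.SmoothPoincare4.SmoothPoincare4.Theorems.EntropyRungChangGurskyYangStubSmoothRoundLimitAux2
import Literature.Geometry.Riemannian.RicciFlowSpatialRicciBounds
import Literature.Geometry.Riemannian.RicciFlowChartRmCovariantNorms
import Literature.Analysis.ODE.OneSidedComparison
import HarnessLib

/-!
# The scaled Ricci flow read in a chart, I: two-sided bounds (Hamilton 1982, §14)
(helper file 3 for stub `stub_smoothRoundLimit`, line `margerin-cone-hamilton-rails`, crux
`EntropyRung.ChangGurskyYang`, item stmt-SmoothPoincare4-10834)

Along a Ricci flow `g(t)` of Riemannian metrics on `[0, T)` on a closed manifold with the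
roundness rates and the scaled Shi bounds near `T`, this file and its two sequels read the flow in
the chart at a point `z` (`chartRep`, the matrix `G_t(y) = g_{ij}(y, t)`) on a closed ball
`B̄(ẑ, r) ⊆ target` and prove the ORDER-ZERO inputs of the smooth convergence of `g(t)/(T−t)`
(Hamilton 1982, §14, Lemma 14.2 and §17, Thm. 17.6), for a general model. Here:

* `shi_uniform_time` — the scaled Shi bounds hold on the whole of `[t₀, T)` (compactness of
  `M × [t₀, t₁]`);
* `scaledChartRep_twoSided_of_envelope` — a two-sided logarithmic envelope
  `e^{−a(t)} G_t(y)(v,v)/(T−t) ≤ ℓ ≤ e^{a(t)} G_t(y)(v,v)/(T−t)` at the points of the ball (the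
  conclusion of `helper_scaledMetric_tendsto`) gives `λ (T−t) |v|² ≤ G_t(y)(v,v)`,
  `‖G_t(y)‖ ≤ C₀ (T−t)` and `|G_t(y)(v,v)/(T−t) − ℓ| ≤ C₀ a(t)|v|²` (comparison with the compact
  slice `t = t₀`).

## References

* R. S. Hamilton, *Three-manifolds with positive Ricci curvature*, J. Differential Geom. 17
  (1982) 255–306, §14, Lemma 14.2; §17, Thm. 17.6. [Hamilton1982]
* P. Topping, *Lectures on the Ricci flow*, LMS Lecture Note Series 325, CUP 2006, §5.3,
  proof of Thm. 5.3.1, p. 47; Thm. 3.3.1. [Topping2006]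
* A. L. Besse, *Einstein manifolds*, Springer 1987, 1.118. [Besse1987]
-/

noncomputable section

-- every `Summit.SmoothPoincare4.SmoothPoincare4.…` name repeats the summit = sub-problem segment (D-0017 layout)
set_option linter.dupNamespace false

-- operator spaces of bilinear forms over the model space
set_option maxSynthPendingDepth 3

open Set Function Filter Real Module Metric
open scoped Manifold ContDiff Topology

namespace Summit.SmoothPoincare4.SmoothPoincare4.Theorems.MargerinRails

open Literature.Geometry.Riemannian
open Literature.Geometry.Lorentzian Literature.Geometry.Lorentzian.PseudoRiemannianMetric
open Literature.Geometry.Lorentzian.MetricCoord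

universe u v w

/-! ### Elementary real inequalities -/

section Elementary

/-- **The deviation from a two-sided logarithmic envelope**: if `0 ≤ ψ`, `0 ≤ a` and
`e^{−a} ψ ≤ ℓ ≤ e^{a} ψ`, then `|ψ − ℓ| ≤ a e^{a} ψ`. [folklore] -/
theorem abs_sub_le_of_envelope {ψ ℓ a : ℝ} (hψ : 0 ≤ ψ) (ha : 0 ≤ a)
    (hlo : exp (-a) * ψ ≤ ℓ) (hup : ℓ ≤ exp a * ψ) : |ψ - ℓ| ≤ a * exp a * ψ := by
  have hE : exp a - 1 ≤ a * exp a := Literature.Analysis.ODE.exp_sub_one_le_mul_exp a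
  have hE0 : 0 ≤ exp a - 1 := by linarith [add_one_le_exp a]
  have hℓ0 : 0 ≤ ℓ := le_trans (mul_nonneg (exp_pos _).le hψ) hlo
  -- `ψ ≤ e^{a} ℓ`
  have hψℓ : ψ ≤ exp a * ℓ := by
    have hea := mul_le_mul_of_nonneg_left hlo (exp_pos a).le
    rwa [← mul_assoc, ← exp_add, add_neg_cancel, exp_zero, one_mul] at hea
  have hd1 : ℓ - ψ ≤ (exp a - 1) * ψ := by rw [sub_mul, one_mul]; linarith
  have hd2 : ψ - ℓ ≤ (exp a - 1) * ψ := by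
    rcases le_or_gt ℓ ψ with h | h
    · have h5 : ψ - ℓ ≤ (exp a - 1) * ℓ := by rw [sub_mul, one_mul]; linarith
      exact h5.trans (mul_le_mul_of_nonneg_left h hE0)
    · exact le_trans (by linarith) (mul_nonneg hE0 hψ)
  exact (abs_sub_le_iff.2 ⟨hd2, hd1⟩).trans (mul_le_mul_of_nonneg_right hE hψ)

end Elementary

/-! ### General model -/

section General

variable {E : Type u} [NormedAddCommGroup E] [NormedSpace ℝ E] [FiniteDimensional ℝ E]
  [CompleteSpace E] {H : Type v} [TopologicalSpace H] {I : ModelWithCorners ℝ E H} [I.Boundaryless]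
  {M : Type w} [TopologicalSpace M] [ChartedSpace H M] [IsManifold I ∞ M]
  {g : ℝ → PseudoRiemannianMetric I ∞ E (TangentSpace I : M → Type _)}
  {cov : ℝ → CovariantDerivative I E (TangentSpace I : M → Type _)} {T t₀ : ℝ}

/-! #### The scaled Shi bounds on the whole of `[t₀, T)` -/

/-- **The scaled Shi bounds hold from `t₀` on**: if `|∇ᵏRm|² ≤ C' (T−t)^{−k−2}` on `M × [t₁, T)`
for some `t₁ < T`, then (with another constant) on `M × [t₀, T)`, the function
`(z, t) ↦ |∇ᵏRm|²(t, z)` being continuous on the compact `M × [t₀, t₁]`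
(`IsRicciFlow.contMDiffOn_curvDerivNormSq`). [cite: Topping2006, Thm. 3.3.1] -/
theorem shi_uniform_time [CompactSpace M] (hflow : IsRicciFlow g cov (Ico 0 T))
    (hR : ∀ t ∈ Ico 0 T, (g t).IsRiemannian) (ht₀ : t₀ ∈ Ico 0 T)
    (hshi : ∀ k : ℕ, ∃ C' t₁ : ℝ, t₁ ∈ Ico 0 T ∧ ∀ t ∈ Ico t₁ T, ∀ z : M,
      curvDerivNormSq I g k t z ≤ C' * ((T - t) ^ (k + 2))⁻¹) (k : ℕ) :
    ∃ C' : ℝ, ∀ t ∈ Ico t₀ T, ∀ z : M, curvDerivNormSq I g k t z ≤ C' * ((T - t) ^ (k + 2))⁻¹ := by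
  obtain ⟨C', t₁, ht₁, hC'⟩ := hshi k
  have hT : 0 < T := ht₀.1.trans_lt ht₀.2
  -- a bound on the compact `M × [t₀, t₁]`
  have hS : UniqueDiffOn ℝ (Ico 0 T) := uniqueDiffOn_Ico 0 T
  have hS' : Ico 0 T ⊆ closure (interior (Ico 0 T)) := by
    rw [interior_Ico, closure_Ioo hT.ne]; exact Ico_subset_Icc_self
  have hcont : ContinuousOn (fun p : M × ℝ ↦ curvDerivNormSq I g k p.2 p.1)
      (univ ×ˢ Icc t₀ t₁) :=
    ((hflow.contMDiffOn_curvDerivNormSq hS hS' hR k).continuousOn).mono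
      (prod_mono Subset.rfl fun t ht ↦ ⟨ht₀.1.trans ht.1, ht.2.trans_lt ht₁.2⟩)
  obtain ⟨B, hB⟩ := (isCompact_univ.prod isCompact_Icc).exists_bound_of_continuousOn hcont
  have hDpos : 0 < (T - t₀) ^ (k + 2) := pow_pos (sub_pos.2 ht₀.2) _
  refine ⟨max C' 0 + max B 0 * (T - t₀) ^ (k + 2), fun t ht z ↦ ?_⟩
  have hTt : 0 < T - t := sub_pos.2 ht.2
  have hpow : 0 < (T - t) ^ (k + 2) := pow_pos hTt _
  have hinv : 0 ≤ ((T - t) ^ (k + 2))⁻¹ := inv_nonneg.2 hpow.le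
  have hnn : 0 ≤ max B 0 * (T - t₀) ^ (k + 2) := mul_nonneg (le_max_right _ _) hDpos.le
  by_cases htt₁ : t₁ ≤ t
  · calc curvDerivNormSq I g k t z ≤ C' * ((T - t) ^ (k + 2))⁻¹ := hC' t ⟨htt₁, ht.2⟩ z
      _ ≤ (max C' 0 + max B 0 * (T - t₀) ^ (k + 2)) * ((T - t) ^ (k + 2))⁻¹ := by
          refine mul_le_mul_of_nonneg_right ?_ hinv
          linarith [le_max_left C' 0]
  · push Not at htt₁
    have hb := hB (z, t) ⟨mem_univ _, ht.1, htt₁.le⟩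
    rw [Real.norm_eq_abs] at hb
    have h1 : curvDerivNormSq I g k t z ≤ max B 0 := (le_abs_self _).trans (hb.trans (le_max_left _ _))
    have hle : (T - t) ^ (k + 2) ≤ (T - t₀) ^ (k + 2) :=
      pow_le_pow_left₀ hTt.le (by linarith [ht.1]) _
    have h2 : max B 0 ≤ max B 0 * (T - t₀) ^ (k + 2) * ((T - t) ^ (k + 2))⁻¹ := by
      rw [mul_assoc]
      refine le_mul_of_one_le_right (le_max_right _ _) ?_
      rw [← div_eq_mul_inv, one_le_div hpow]
      exact hle
    calc curvDerivNormSq I g k t z ≤ max B 0 * (T - t₀) ^ (k + 2) * ((T - t) ^ (k + 2))⁻¹ := h1.trans h2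
      _ ≤ (max C' 0 + max B 0 * (T - t₀) ^ (k + 2)) * ((T - t) ^ (k + 2))⁻¹ := by
          refine mul_le_mul_of_nonneg_right ?_ hinv
          linarith [le_max_right C' 0]

/-! #### Two-sided bounds of the scaled representative from an envelope -/

omit [FiniteDimensional ℝ E] [CompleteSpace E] [I.Boundaryless] in
/-- Unfolding: the chart representative on a pair of model vectors is the metric on the frame
vectors of the trivialization at `z`. [folklore] -/
theorem chartRep_apply_eq_val (z : M) (t : ℝ) (y v w : E) :
    chartRep I g z t y v w = (g t).val ((extChartAt I z).symm y)
      ((trivializationAt E (TangentSpace I : M → Type _) z).symmL ℝ ((extChartAt I z).symm y) v)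
      ((trivializationAt E (TangentSpace I : M → Type _) z).symmL ℝ ((extChartAt I z).symm y) w) := rfl

omit [CompleteSpace E] in
/-- **The scaled chart representative is uniformly positive definite and bounded, from a two-sided
logarithmic envelope** (Hamilton 1982, Lemma 14.2: "if `∫|∂ₜg| < ∞` the metrics are uniformly
equivalent"). Let `g` be a family of Riemannian metrics, `C^∞` on `M × [0, T)`, and on a closed
ball `B̄(ẑ, r) ⊆ target` of the chart at `z` suppose that for every `y`, `v` the scaled diagonal
entry `ψ(s) = G_s(y)(v,v)/(T−s)` admits an `ℓ` with `e^{−a(t)} ψ(t) ≤ ℓ ≤ e^{a(t)} ψ(t)` on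
`[t₀, T)`, where `0 ≤ a(t) ≤ a(t₀)`. Then there are `λ > 0`, `C₀` with, on `B̄(ẑ, r) × [t₀, T)`:
`λ (T−t) |v|² ≤ G_t(y)(v,v)`, `‖G_t(y)‖ ≤ C₀ (T−t)`, and `|ψ(t) − ℓ| ≤ C₀ a(t) |v|²` for every such
`ℓ` (comparison with the compact slice `t = t₀`, where `G_{t₀}` is positive definite and
continuous). [cite: Hamilton1982, §14, Lemma 14.2] [cite: Topping2006, §5.3, proof of Thm. 5.3.1, p. 47] -/
theorem scaledChartRep_twoSided_of_envelope (hsm : IsContMDiffFamilyOn ∞ g (Ico 0 T))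
    (hR : ∀ t ∈ Ico 0 T, (g t).IsRiemannian) (ht₀ : t₀ ∈ Ico 0 T) {a : ℝ → ℝ}
    (ha : ∀ t ∈ Ico t₀ T, 0 ≤ a t ∧ a t ≤ a t₀) (z : M) {r : ℝ} (hr : 0 ≤ r)
    (hcl : closedBall (extChartAt I z z) r ⊆ (extChartAt I z).target)
    (henv : ∀ y ∈ closedBall (extChartAt I z z) r, ∀ v : E, ∃ ℓ : ℝ, ∀ t ∈ Ico t₀ T,
      exp (-a t) * (chartRep I g z t y v v / (T - t)) ≤ ℓ ∧
        ℓ ≤ exp (a t) * (chartRep I g z t y v v / (T - t))) :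
    ∃ lam > (0 : ℝ), ∃ C₀ : ℝ, ∀ t ∈ Ico t₀ T, ∀ y ∈ closedBall (extChartAt I z z) r,
      (∀ v, lam * (T - t) * ‖v‖ ^ 2 ≤ chartRep I g z t y v v) ∧
      ‖chartRep I g z t y‖ ≤ C₀ * (T - t) ∧
      ∀ (v : E) (ℓ : ℝ), (∀ s ∈ Ico t₀ T,
        exp (-a s) * (chartRep I g z s y v v / (T - s)) ≤ ℓ ∧
          ℓ ≤ exp (a s) * (chartRep I g z s y v v / (T - s))) →
        |chartRep I g z t y v v / (T - t) - ℓ| ≤ C₀ * a t * ‖v‖ ^ 2 := by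
  have ht₀' : t₀ ∈ Ico t₀ T := ⟨le_rfl, ht₀.2⟩
  have hT₀ : 0 < T - t₀ := sub_pos.2 ht₀.2
  have hA0 : 0 ≤ a t₀ := (ha t₀ ht₀').1
  -- `G_{t₀}` on the compact ball
  have hG0 : ContinuousOn (chartRep I g z t₀) (closedBall (extChartAt I z z) r) := by
    have hsm' : ContDiffOn ℝ ∞ (fun q : E × ℝ ↦ chartRep I g z q.2 q.1)
        ((extChartAt I z).target ×ˢ Ico 0 T) := contDiffOn_chartRep hsm z
    have hι : ContinuousOn (fun y : E ↦ ((y, t₀) : E × ℝ)) (closedBall (extChartAt I z z) r) :=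
      (continuous_id.prodMk continuous_const).continuousOn
    have hcomp := hsm'.continuousOn.comp hι fun y hy ↦ ⟨hcl hy, ht₀⟩
    exact hcomp
  obtain ⟨lam₀, hlam₀, hlam₀le⟩ := exists_pos_le_quadratic_of_isCompact (isCompact_closedBall _ r) hG0
    (fun y hy v hv ↦ chartRep_pos (hR t₀ ht₀) z ⟨y, hcl hy⟩ v hv)
  obtain ⟨M₀, hM₀⟩ := (isCompact_closedBall _ r).exists_bound_of_continuousOn hG0
  have hM₀nn : 0 ≤ M₀ := (norm_nonneg _).trans (hM₀ _ (mem_closedBall_self hr))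
  -- the comparison with `t₀`
  have hcomp : ∀ y ∈ closedBall (extChartAt I z z) r, ∀ t ∈ Ico t₀ T, ∀ (v : E) (ℓ : ℝ),
      (∀ s ∈ Ico t₀ T, exp (-a s) * (chartRep I g z s y v v / (T - s)) ≤ ℓ ∧
        ℓ ≤ exp (a s) * (chartRep I g z s y v v / (T - s))) →
      exp (-(2 * a t₀)) * (lam₀ / (T - t₀)) * ‖v‖ ^ 2 ≤ chartRep I g z t y v v / (T - t) ∧
      chartRep I g z t y v v / (T - t) ≤ exp (2 * a t₀) * (M₀ / (T - t₀)) * ‖v‖ ^ 2 ∧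
      |chartRep I g z t y v v / (T - t) - ℓ| ≤
        (exp (a t₀) * (exp (2 * a t₀) * (M₀ / (T - t₀)))) * a t * ‖v‖ ^ 2 := by
    intro y hy t ht v ℓ hℓ
    obtain ⟨h0lo, h0up⟩ := hℓ t₀ ht₀'
    obtain ⟨h1lo, h1up⟩ := hℓ t ht
    obtain ⟨hat, hatA⟩ := ha t ht
    have hTt : 0 < T - t := sub_pos.2 ht.2
    -- `ψ(t₀)` against `λ₀`, `M₀`
    have hψ₀lo : lam₀ * ‖v‖ ^ 2 / (T - t₀) ≤ chartRep I g z t₀ y v v / (T - t₀) :=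
      div_le_div_of_nonneg_right (hlam₀le y hy v) hT₀.le
    have hψ₀up : chartRep I g z t₀ y v v / (T - t₀) ≤ M₀ * ‖v‖ ^ 2 / (T - t₀) := by
      refine div_le_div_of_nonneg_right ?_ hT₀.le
      have h1 := abs_apply₂_le (chartRep I g z t₀ y) v v
      have h2 : ‖chartRep I g z t₀ y‖ * ‖v‖ * ‖v‖ ≤ M₀ * ‖v‖ * ‖v‖ := by
        gcongr; exact hM₀ y hy
      have h3 := le_abs_self (chartRep I g z t₀ y v v)
      calc chartRep I g z t₀ y v v ≤ M₀ * ‖v‖ * ‖v‖ := h3.trans (h1.trans h2)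
        _ = M₀ * ‖v‖ ^ 2 := by ring
    -- `ℓ` against `ψ(t₀)`
    have hℓup : ℓ ≤ exp (a t₀) * (M₀ * ‖v‖ ^ 2 / (T - t₀)) :=
      h0up.trans (mul_le_mul_of_nonneg_left hψ₀up (exp_pos _).le)
    have hℓlo : exp (-a t₀) * (lam₀ * ‖v‖ ^ 2 / (T - t₀)) ≤ ℓ :=
      le_trans (mul_le_mul_of_nonneg_left hψ₀lo (exp_pos _).le) h0lo
    have hℓnn : 0 ≤ ℓ := le_trans (mul_nonneg (exp_pos _).le
      (div_nonneg (mul_nonneg hlam₀.le (sq_nonneg _)) hT₀.le)) hℓlo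
    -- `ψ(t)` against `ℓ`
    have hψup : chartRep I g z t y v v / (T - t) ≤ exp (a t) * ℓ := by
      have hea := mul_le_mul_of_nonneg_left h1lo (exp_pos (a t)).le
      rwa [← mul_assoc, ← exp_add, add_neg_cancel, exp_zero, one_mul] at hea
    have hψlo : exp (-a t) * ℓ ≤ chartRep I g z t y v v / (T - t) := by
      have hea := mul_le_mul_of_nonneg_left h1up (exp_pos (-a t)).le
      rwa [← mul_assoc, ← exp_add, neg_add_cancel, exp_zero, one_mul] at hea
    -- upper bound
    have hup : chartRep I g z t y v v / (T - t) ≤ exp (2 * a t₀) * (M₀ / (T - t₀)) * ‖v‖ ^ 2 := by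
      have h2 : exp (a t) * ℓ ≤ exp (a t₀) * ℓ :=
        mul_le_mul_of_nonneg_right (exp_le_exp.2 hatA) hℓnn
      have h3 : exp (a t₀) * ℓ ≤ exp (a t₀) * (exp (a t₀) * (M₀ * ‖v‖ ^ 2 / (T - t₀))) :=
        mul_le_mul_of_nonneg_left hℓup (exp_pos _).le
      have h4 : exp (a t₀) * (exp (a t₀) * (M₀ * ‖v‖ ^ 2 / (T - t₀))) =
          exp (2 * a t₀) * (M₀ / (T - t₀)) * ‖v‖ ^ 2 := by
        rw [show 2 * a t₀ = a t₀ + a t₀ by ring, exp_add]; ring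
      exact hψup.trans (h2.trans (h3.trans h4.le))
    -- lower bound
    have hlo : exp (-(2 * a t₀)) * (lam₀ / (T - t₀)) * ‖v‖ ^ 2 ≤ chartRep I g z t y v v / (T - t) := by
      have h2 : exp (-a t₀) * ℓ ≤ exp (-a t) * ℓ :=
        mul_le_mul_of_nonneg_right (exp_le_exp.2 (neg_le_neg hatA)) hℓnn
      have h3 : exp (-a t₀) * (exp (-a t₀) * (lam₀ * ‖v‖ ^ 2 / (T - t₀))) ≤ exp (-a t₀) * ℓ :=
        mul_le_mul_of_nonneg_left hℓlo (exp_pos _).le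
      have h4 : exp (-(2 * a t₀)) * (lam₀ / (T - t₀)) * ‖v‖ ^ 2 =
          exp (-a t₀) * (exp (-a t₀) * (lam₀ * ‖v‖ ^ 2 / (T - t₀))) := by
        rw [show -(2 * a t₀) = -a t₀ + -a t₀ by ring, exp_add]; ring
      exact h4.le.trans (h3.trans (h2.trans hψlo))
    refine ⟨hlo, hup, ?_⟩
    -- the rate: `|ψ − ℓ| ≤ a e^{a} ψ`
    have hψnn : 0 ≤ chartRep I g z t y v v / (T - t) :=
      le_trans (mul_nonneg (mul_nonneg (exp_pos _).le (div_nonneg hlam₀.le hT₀.le)) (sq_nonneg _)) hlo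
    have hdev := abs_sub_le_of_envelope hψnn hat h1lo h1up
    refine hdev.trans ?_
    have h6 : a t * exp (a t) * (chartRep I g z t y v v / (T - t)) ≤
        a t * exp (a t₀) * (exp (2 * a t₀) * (M₀ / (T - t₀)) * ‖v‖ ^ 2) := by
      have h7 : a t * exp (a t) ≤ a t * exp (a t₀) :=
        mul_le_mul_of_nonneg_left (exp_le_exp.2 hatA) hat
      exact mul_le_mul h7 hup hψnn (mul_nonneg hat (exp_pos _).le)
    calc a t * exp (a t) * (chartRep I g z t y v v / (T - t))
        ≤ a t * exp (a t₀) * (exp (2 * a t₀) * (M₀ / (T - t₀)) * ‖v‖ ^ 2) := h6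
      _ = (exp (a t₀) * (exp (2 * a t₀) * (M₀ / (T - t₀)))) * a t * ‖v‖ ^ 2 := by ring
  -- the constants
  have hK₀nn : 0 ≤ exp (2 * a t₀) * (M₀ / (T - t₀)) := mul_nonneg (exp_pos _).le (div_nonneg hM₀nn hT₀.le)
  refine ⟨exp (-(2 * a t₀)) * (lam₀ / (T - t₀)), mul_pos (exp_pos _) (div_pos hlam₀ hT₀),
    max (2 * (exp (2 * a t₀) * (M₀ / (T - t₀)))) (exp (a t₀) * (exp (2 * a t₀) * (M₀ / (T - t₀)))),
    fun t ht y hy ↦ ⟨fun v ↦ ?_, ?_, fun v ℓ hℓ ↦ ?_⟩⟩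
  · -- lower bound
    obtain ⟨ℓ, hℓ⟩ := henv y hy v
    have h := (hcomp y hy t ht v ℓ hℓ).1
    have hTt : 0 < T - t := sub_pos.2 ht.2
    have h' := (le_div_iff₀ hTt).1 h
    calc exp (-(2 * a t₀)) * (lam₀ / (T - t₀)) * (T - t) * ‖v‖ ^ 2
        = exp (-(2 * a t₀)) * (lam₀ / (T - t₀)) * ‖v‖ ^ 2 * (T - t) := by ring
      _ ≤ chartRep I g z t y v v := h'
  · -- operator norm
    have hTt : 0 < T - t := sub_pos.2 ht.2
    have hsymm : ∀ v w, chartRep I g z t y v w = chartRep I g z t y w v :=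
      fun v w ↦ chartRep_symm z t (hcl hy) v w
    have hq : ∀ v, |chartRep I g z t y v v| ≤ exp (2 * a t₀) * (M₀ / (T - t₀)) * (T - t) * ‖v‖ ^ 2 := by
      intro v
      obtain ⟨ℓ, hℓ⟩ := henv y hy v
      obtain ⟨hlo, hup, -⟩ := hcomp y hy t ht v ℓ hℓ
      have h1 : 0 ≤ exp (-(2 * a t₀)) * (lam₀ / (T - t₀)) * ‖v‖ ^ 2 :=
        mul_nonneg (mul_nonneg (exp_pos _).le (div_nonneg hlam₀.le hT₀.le)) (sq_nonneg _)
      have h2 := (le_div_iff₀ hTt).1 hlo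
      have hnn : 0 ≤ chartRep I g z t y v v := le_trans (mul_nonneg h1 hTt.le) h2
      rw [abs_of_nonneg hnn]
      calc chartRep I g z t y v v ≤ exp (2 * a t₀) * (M₀ / (T - t₀)) * ‖v‖ ^ 2 * (T - t) :=
            (div_le_iff₀ hTt).1 hup
        _ = exp (2 * a t₀) * (M₀ / (T - t₀)) * (T - t) * ‖v‖ ^ 2 := by ring
    calc ‖chartRep I g z t y‖ ≤ 2 * (exp (2 * a t₀) * (M₀ / (T - t₀)) * (T - t)) :=
          norm_le_of_quadratic_le hsymm (mul_nonneg hK₀nn hTt.le) hq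
      _ = 2 * (exp (2 * a t₀) * (M₀ / (T - t₀))) * (T - t) := by ring
      _ ≤ _ := mul_le_mul_of_nonneg_right (le_max_left _ _) hTt.le
  · -- the rate on the diagonal
    refine (hcomp y hy t ht v ℓ hℓ).2.2.trans ?_
    have hnn : 0 ≤ a t * ‖v‖ ^ 2 := mul_nonneg (ha t ht).1 (sq_nonneg _)
    calc exp (a t₀) * (exp (2 * a t₀) * (M₀ / (T - t₀))) * a t * ‖v‖ ^ 2
        = exp (a t₀) * (exp (2 * a t₀) * (M₀ / (T - t₀))) * (a t * ‖v‖ ^ 2) := by ring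
      _ ≤ max (2 * (exp (2 * a t₀) * (M₀ / (T - t₀)))) (exp (a t₀) * (exp (2 * a t₀) * (M₀ / (T - t₀))))
            * (a t * ‖v‖ ^ 2) := mul_le_mul_of_nonneg_right (le_max_right _ _) hnn
      _ = _ := by ring


/-- **HELPER `helper_scaledChartRep_twoSided`** — the registered form of
`scaledChartRep_twoSided_of_envelope` (two-sided bounds of the scaled chart representative from a
two-sided logarithmic envelope; Hamilton 1982, Lemma 14.2). [cite: Hamilton1982, §14, Lemma 14.2] -/
theorem helper_scaledChartRep_twoSided : ∀ {E : Type u} [NormedAddCommGroup E] [NormedSpace ℝ E] [FiniteDimensional ℝ E] {H : Type v} [TopologicalSpace H] {I : ModelWithCorners ℝ E H} [I.Boundaryless] {M : Type w} [TopologicalSpace M] [ChartedSpace H M] [IsManifold I ∞ M] {g : ℝ → PseudoRiemannianMetric I ∞ E (TangentSpace I : M → Type _)} {T t₀ : ℝ} {a : ℝ → ℝ} (z : M) {r : ℝ}, IsContMDiffFamilyOn ∞ g (Ico 0 T) → (∀ t ∈ Ico 0 T, (g t).IsRiemannian) → t₀ ∈ Ico 0 T → (∀ t ∈ Ico t₀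 T, 0 ≤ a t ∧ a t ≤ a t₀) → 0 ≤ r → Metric.closedBall (extChartAt I z z) r ⊆ (extChartAt I z).target → (∀ y ∈ Metric.closedBall (extChartAt I z z) r, ∀ v : E, ∃ ℓ : ℝ, ∀ t ∈ Ico t₀ T, Real.exp (-a t) * (chartRep I g z t y v v / (T - t)) ≤ ℓ ∧ ℓ ≤ Real.exp (a t) * (chartRep I g z t y v v / (T - t))) → ∃ lam > (0 : ℝ), ∃ C₀ : ℝ, ∀ t ∈ Ico t₀ T, ∀ y ∈ Metric.closedBall (extChartAt I z z) r, (∀ v, lam * (T - t) * ‖v‖ ^ 2 ≤ chartRep I g z t y v v) ∧ ‖chartRep I g z t y‖ ≤ C₀ * (T - t) ∧ ∀ (v : E) (ℓ : ℝ), (∀ s ∈ Ico t₀ T, Real.exp (-a s) * (chartRep I g z s y v v / (T - s)) ≤ ℓ ∧ ℓ ≤ Real.exp (a s) * (chartRep I g z s y v v / (T - s))) → |chartRep I g z t y v v / (T - t) - ℓ| ≤ C₀ * a t * ‖v‖ ^ 2 := by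
  intro E _ _ _ H _ I _ M _ _ _ g T t₀ a z r hsm hR ht₀ ha hr hcl henv
  exact scaledChartRep_twoSided_of_envelope hsm hR ht₀ ha z hr hcl henv

end General

end Summit.SmoothPoincare4.SmoothPoincare4.Theorems.MargerinRails

end
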